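import Summits.CriticalPhenomena.CardyFormulaZ2.Theorems.CardyGluingRDEBoxMergingRefinement
import Literature.Probability.Percolation.MultiResTVSegments

/-!
# `CardyGluingRDE`: exactness of OR-fusion, and the route's `Dw` IS the Literature metric
# `segMultiResTV` on the reading laws (stmt-CriticalPhenomena-8582 / stmt-CriticalPhenomena-8580)

Route `CardyGluingRDE` (sub-problem `CardyFormulaZ2`) inlines, in `BoxMerging` (stmt-8582) and
`GluingContraction` (stmt-8580), the discrepancies `TV_j(u,u')` (half the `ℓ¹` distance between
the bond-`ℤ²` and site-`𝕋` laws of the resolution-`j` segment-connectivity matrix of the square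
`(0, δ₀)²`) and `Dw_K = Σ_{j ≤ K} 2^(−σj) TV_j`.  The definition request `defn-MultiResTV` landed
the typed side in `Literature/Probability/Percolation/MultiResTV.lean` /
`MultiResTVSegments.lean`: `SegMatrix k`, the OR-fusion `SegMatrix.coarsen K j`, the pseudometric
`segMultiResTV σ K` on `PMF (SegMatrix (2^K))`, and the bridge `route_Dw_eq_segMultiResTV`
(`Dw σ δ₀ K u u' = segMultiResTV σ K μ ν` for any laws `μ, ν` whose coarsenings have the route's
reading vectors as coordinates), explicitly leaving open "the claim that coarsening the
resolution-`K` reading gives the resolution-`j` reading (exactness of OR-fusion, a lemma about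
discrete arcs of unions of segments)".  This file proves that claim and draws the consequences:

* `BoxMerging_iUnion_stateEvent`, `BoxMerging_mem_stateEvent_iff`,
  `BoxMerging_sum_measure(Real)_stateEvent` — the state cells `{ω | ∀ a b, ω ∈ C a b ↔ M a b}`
  partition the configuration space; under a probability measure they carry total mass `1`;
* `BoxMerging_tv_le_one`, `BoxMerging_dw_le` — a priori bounds `TV_j ≤ 1`,
  `Dw_K ≤ Σ_{j ≤ K} 2^(−σj)` (route notation verbatim; every `ℤ²`-mesh, every `𝕋`-mesh `u' > 0`);
* `BoxMerging_coarsen_succ_of_biUnion`, `BoxMerging_coarsen_read` — **EXACTNESS OF OR-FUSION**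
  (abstract over a tower of event families `E j a b` in which each level-`j` event is the union
  of the level-`(j+1)` events between children — supplied on both lattices by
  `BoxMerging_discreteCrossing_succ` / `BoxMerging_triCrossing_succ` of
  `CardyGluingRDEBoxMergingRefinement.lean`): `SegMatrix.coarsen K j` of the level-`K` reading of
  `ω` is its level-`j` reading, for all `j ≤ K`;
* `BoxMerging_stateEvent_eq_biUnion_fiber`, `BoxMerging_exists_pmf_reading` — hence the level-`j`
  cells are the unions of the level-`K` cells over the fibres of `coarsen K j`, and the level-`K`
  cell law, as a `PMF (SegMatrix (2^K))`, pushes forward under `coarsen K j` to the level-`j`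
  cell law;
* `BoxMerging_dw_eq_segMultiResTV` — **the route's `Dw σ δ₀ K u u'` equals
  `segMultiResTV σ K μ ν`** for the two level-`K` reading laws `μ` (bond-`ℤ²`, mesh `u`) and `ν`
  (site-`𝕋`, mesh `u' > 0`), and `TV δ₀ j u u'` is the total-variation distance `PMF.tvDist` of
  their level-`j` push-forwards (`j ≤ K`) — so the whole `multiResTV` API (pseudometric axioms,
  `2^(−σj) Δ_j ≤ Dw ≤ Σ 2^(−σj)`, data processing) applies to the inlined `Dw` of stmt-8580/8582.

References: Langlands–Pouliot–Saint-Aubin, Bull. AMS 30 (1994) §2.3 ("these intervals are then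
fused in pairs"); Smirnov, C. R. Acad. Sci. 333 (2001) §2 (discrete arcs); Schramm–Smirnov,
EJP 16 (2011) §1.
-/

noncomputable section

namespace Summit.CriticalPhenomena.CardyFormulaZ2.Theorems

open scoped BigOperators Topology ENNReal
open Filter Set MeasureTheory
open Literature.Probability.Percolation Literature.Probability.RandomPlanarGeometry
  Literature.Probability.LatticeModels
open Summit.CriticalPhenomena.CardyFormulaZ2.Theses.CardyGluingRDE

/-! ### State cells: partition, reading, total mass -/

section Cells

variable {Ω κ : Type*}

/-- The state cells `{ω | ∀ a b, ω ∈ C a b ↔ M a b}` cover the configuration space (every `ω`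
reads exactly one matrix). [folklore] -/
theorem BoxMerging_iUnion_stateEvent (C : κ → κ → Set Ω) :
    (⋃ M : κ → κ → Bool, {ω | ∀ a b, ω ∈ C a b ↔ M a b = true}) = univ := by
  classical
  exact eq_univ_of_forall fun ω => mem_iUnion.2 ⟨fun a b => decide (ω ∈ C a b), fun a b => by simp⟩

/-- Membership in a state cell: `ω` lies in the cell of `M` iff the matrix READ from `ω`
(`(a, b) ↦ [ω ∈ C a b]`) is `M`. [folklore] -/
theorem BoxMerging_mem_stateEvent_iff (C : κ → κ → Set Ω) [∀ (ω : Ω) a b, Decidable (ω ∈ C a b)]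
    (M : κ → κ → Bool) (ω : Ω) :
    ω ∈ {ω | ∀ a b, ω ∈ C a b ↔ M a b = true} ↔ (fun a b => decide (ω ∈ C a b)) = M := by
  simp only [mem_setOf_eq]
  constructor
  · intro h
    funext a b
    rw [Bool.eq_iff_iff, decide_eq_true_iff]
    exact h a b
  · rintro rfl a b
    simp

/-- Under a probability measure the state cells of measurable events have total mass `1`
(`ℝ≥0∞`-valued; they partition the space). [folklore] -/
theorem BoxMerging_sum_measure_stateEvent [MeasurableSpace Ω] [Fintype κ] [DecidableEq κ]
    (μ : Measure Ω) [IsProbabilityMeasure μ] (C : κ → κ → Set Ω)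
    (hC : ∀ a b, MeasurableSet (C a b)) :
    ∑ M : κ → κ → Bool, μ {ω | ∀ a b, ω ∈ C a b ↔ M a b = true} = 1 := by
  rw [← measure_biUnion_finset ((BoxMerging_pairwise_disjoint_stateEvent C).set_pairwise _)
    (fun M _ => BoxMerging_measurableSet_stateEvent C hC M)]
  simp only [Finset.mem_univ, iUnion_true]
  rw [BoxMerging_iUnion_stateEvent, measure_univ]

/-- Under a probability measure the state cells of measurable events have total mass `1`
(real-valued). [folklore] -/
theorem BoxMerging_sum_measureReal_stateEvent [MeasurableSpace Ω] [Fintype κ] [DecidableEq κ]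
    (μ : Measure Ω) [IsProbabilityMeasure μ] (C : κ → κ → Set Ω)
    (hC : ∀ a b, MeasurableSet (C a b)) :
    ∑ M : κ → κ → Bool, μ.real {ω | ∀ a b, ω ∈ C a b ↔ M a b = true} = 1 := by
  rw [← measureReal_biUnion_finset ((BoxMerging_pairwise_disjoint_stateEvent C).set_pairwise _)
    (fun M _ => BoxMerging_measurableSet_stateEvent C hC M)]
  simp only [Finset.mem_univ, iUnion_true]
  rw [BoxMerging_iUnion_stateEvent, probReal_univ]

end Cells

/-! ### A priori bounds on the route's `TV_j` and `Dw_K` -/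

/-- **`TV_j ≤ 1`** (every `δ₀ > 0`, `j`, every `ℤ²`-mesh `u`, every `𝕋`-mesh `u' > 0`): both state
laws are probability vectors, so half their `ℓ¹` distance is at most `1`.  Notation of
`BoxMerging`, verbatim. [folklore] -/
theorem BoxMerging_tv_le_one :
    let PZ := Literature.Probability.Percolation.bondPercolation
      (Literature.Probability.LatticeModels.zdGraph 2) Literature.Probability.Percolation.half
    let PT := Literature.Probability.LatticeModels.triSitePercolation
      Literature.Probability.Percolation.half
    let Sq : ℝ → Set ℂ := fun δ₀ => {z : ℂ | 0 < z.re ∧ z.re < δ₀ ∧ 0 < z.im ∧ z.im < δ₀}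
    let seg : (δ₀ : ℝ) → (j : ℕ) → Fin 4 × Fin (2 ^ j) → Set ℂ := fun δ₀ j a =>
      {z : ℂ | (a.1 = 0 ∧ z.im = 0 ∧ δ₀ * ((a.2 : ℕ) : ℝ) / 2 ^ j ≤ z.re ∧
          z.re ≤ δ₀ * (((a.2 : ℕ) : ℝ) + 1) / 2 ^ j) ∨
        (a.1 = 1 ∧ z.re = δ₀ ∧ δ₀ * ((a.2 : ℕ) : ℝ) / 2 ^ j ≤ z.im ∧
          z.im ≤ δ₀ * (((a.2 : ℕ) : ℝ) + 1) / 2 ^ j) ∨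
        (a.1 = 2 ∧ z.im = δ₀ ∧ δ₀ * ((a.2 : ℕ) : ℝ) / 2 ^ j ≤ z.re ∧
          z.re ≤ δ₀ * (((a.2 : ℕ) : ℝ) + 1) / 2 ^ j) ∨
        (a.1 = 3 ∧ z.re = 0 ∧ δ₀ * ((a.2 : ℕ) : ℝ) / 2 ^ j ≤ z.im ∧
          z.im ≤ δ₀ * (((a.2 : ℕ) : ℝ) + 1) / 2 ^ j)}
    let EZ : (δ₀ : ℝ) → (j : ℕ) → ℝ → ((Fin 4 × Fin (2 ^ j)) → (Fin 4 × Fin (2 ^ j)) → Bool) →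
        Set (Literature.Probability.Percolation.BondConfig
          (Literature.Probability.LatticeModels.Site 2)) := fun δ₀ j u M =>
      {ω | ∀ a b, ω ∈ Literature.Probability.Percolation.discreteCrossing (Sq δ₀) u (seg δ₀ j a)
        (seg δ₀ j b) ↔ M a b = true}
    let ET : (δ₀ : ℝ) → (j : ℕ) → ℝ → ((Fin 4 × Fin (2 ^ j)) → (Fin 4 × Fin (2 ^ j)) → Bool) →
        Set (Literature.Probability.Percolation.SiteConfig
          (Literature.Probability.LatticeModels.Site 2)) := fun δ₀ j u M =>
      {ω | ∀ a b, ω ∈ Literature.Probability.LatticeModels.triCrossing (Sq δ₀) u (seg δ₀ j a)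
        (seg δ₀ j b) ↔ M a b = true}
    let TV : ℝ → ℕ → ℝ → ℝ → ℝ := fun δ₀ j u u' => (1 / 2 : ℝ) *
      ∑ M : (Fin 4 × Fin (2 ^ j)) → (Fin 4 × Fin (2 ^ j)) → Bool,
        |PZ.real (EZ δ₀ j u M) - PT.real (ET δ₀ j u' M)|
    ∀ δ₀ : ℝ, 0 < δ₀ → ∀ (j : ℕ) (u u' : ℝ), 0 < u' → TV δ₀ j u u' ≤ 1 := by
  intro PZ PT Sq seg EZ ET TV δ₀ hδ₀ j u u' hu'
  have hSqR : Sq δ₀ = (rectQuad 0 δ₀ 0 δ₀ hδ₀ hδ₀).carrier := BoxMerging_sq_eq_rectQuad_carrier hδ₀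
  have hbdd : Bornology.IsBounded (Sq δ₀) := by
    rw [hSqR]; exact (rectQuad 0 δ₀ 0 δ₀ hδ₀ hδ₀).isBounded
  have h1 : ∑ M, PZ.real (EZ δ₀ j u M) = 1 :=
    BoxMerging_sum_measureReal_stateEvent PZ
      (fun a b => discreteCrossing (Sq δ₀) u (seg δ₀ j a) (seg δ₀ j b))
      fun a b => measurableSet_discreteCrossing (Sq δ₀) u (seg δ₀ j a) (seg δ₀ j b)
  have h2 : ∑ M, PT.real (ET δ₀ j u' M) = 1 :=
    BoxMerging_sum_measureReal_stateEvent PT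
      (fun a b => triCrossing (Sq δ₀) u' (seg δ₀ j a) (seg δ₀ j b))
      fun a b => BoxMerging_measurableSet_triCrossing hbdd hu' (seg δ₀ j a) (seg δ₀ j b)
  exact tvFin_le_one (fun M => measureReal_nonneg) (fun M => measureReal_nonneg) h1 h2

/-- **`Dw_K ≤ Σ_{j ≤ K} 2^(−σj)`** (every `σ`, `δ₀ > 0`, `K`, `ℤ²`-mesh `u`, `𝕋`-mesh `u' > 0`),
from `TV_j ≤ 1`.  Notation of `GluingContraction`, verbatim. [folklore] -/
theorem BoxMerging_dw_le :
    let PZ := Literature.Probability.Percolation.bondPercolation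
      (Literature.Probability.LatticeModels.zdGraph 2) Literature.Probability.Percolation.half
    let PT := Literature.Probability.LatticeModels.triSitePercolation
      Literature.Probability.Percolation.half
    let Sq : ℝ → Set ℂ := fun δ₀ => {z : ℂ | 0 < z.re ∧ z.re < δ₀ ∧ 0 < z.im ∧ z.im < δ₀}
    let seg : (δ₀ : ℝ) → (j : ℕ) → Fin 4 × Fin (2 ^ j) → Set ℂ := fun δ₀ j a =>
      {z : ℂ | (a.1 = 0 ∧ z.im = 0 ∧ δ₀ * ((a.2 : ℕ) : ℝ) / 2 ^ j ≤ z.re ∧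
          z.re ≤ δ₀ * (((a.2 : ℕ) : ℝ) + 1) / 2 ^ j) ∨
        (a.1 = 1 ∧ z.re = δ₀ ∧ δ₀ * ((a.2 : ℕ) : ℝ) / 2 ^ j ≤ z.im ∧
          z.im ≤ δ₀ * (((a.2 : ℕ) : ℝ) + 1) / 2 ^ j) ∨
        (a.1 = 2 ∧ z.im = δ₀ ∧ δ₀ * ((a.2 : ℕ) : ℝ) / 2 ^ j ≤ z.re ∧
          z.re ≤ δ₀ * (((a.2 : ℕ) : ℝ) + 1) / 2 ^ j) ∨
        (a.1 = 3 ∧ z.re = 0 ∧ δ₀ * ((a.2 : ℕ) : ℝ) / 2 ^ j ≤ z.im ∧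
          z.im ≤ δ₀ * (((a.2 : ℕ) : ℝ) + 1) / 2 ^ j)}
    let EZ : (δ₀ : ℝ) → (j : ℕ) → ℝ → ((Fin 4 × Fin (2 ^ j)) → (Fin 4 × Fin (2 ^ j)) → Bool) →
        Set (Literature.Probability.Percolation.BondConfig
          (Literature.Probability.LatticeModels.Site 2)) := fun δ₀ j u M =>
      {ω | ∀ a b, ω ∈ Literature.Probability.Percolation.discreteCrossing (Sq δ₀) u (seg δ₀ j a)
        (seg δ₀ j b) ↔ M a b = true}
    let ET : (δ₀ : ℝ) → (j : ℕ) → ℝ → ((Fin 4 × Fin (2 ^ j)) → (Fin 4 × Fin (2 ^ j)) → Bool) →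
        Set (Literature.Probability.Percolation.SiteConfig
          (Literature.Probability.LatticeModels.Site 2)) := fun δ₀ j u M =>
      {ω | ∀ a b, ω ∈ Literature.Probability.LatticeModels.triCrossing (Sq δ₀) u (seg δ₀ j a)
        (seg δ₀ j b) ↔ M a b = true}
    let TV : ℝ → ℕ → ℝ → ℝ → ℝ := fun δ₀ j u u' => (1 / 2 : ℝ) *
      ∑ M : (Fin 4 × Fin (2 ^ j)) → (Fin 4 × Fin (2 ^ j)) → Bool,
        |PZ.real (EZ δ₀ j u M) - PT.real (ET δ₀ j u' M)|
    let Dw : ℝ → ℝ → ℕ → ℝ → ℝ → ℝ := fun σ δ₀ K u u' =>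
      ∑ j ∈ Finset.range (K + 1), (2 : ℝ) ^ (-(σ * (j : ℝ))) * TV δ₀ j u u'
    ∀ (σ δ₀ : ℝ), 0 < δ₀ → ∀ (K : ℕ) (u u' : ℝ), 0 < u' →
      Dw σ δ₀ K u u' ≤ ∑ j ∈ Finset.range (K + 1), (2 : ℝ) ^ (-(σ * (j : ℝ))) := by
  intro PZ PT Sq seg EZ ET TV Dw σ δ₀ hδ₀ K u u' hu'
  show ∑ j ∈ Finset.range (K + 1), (2 : ℝ) ^ (-(σ * (j : ℝ))) * TV δ₀ j u u' ≤
    ∑ j ∈ Finset.range (K + 1), (2 : ℝ) ^ (-(σ * (j : ℝ)))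
  refine Finset.sum_le_sum fun j _ => ?_
  have h2 : 0 ≤ (2 : ℝ) ^ (-(σ * (j : ℝ))) := Real.rpow_nonneg (by norm_num) _
  calc (2 : ℝ) ^ (-(σ * (j : ℝ))) * TV δ₀ j u u' ≤ (2 : ℝ) ^ (-(σ * (j : ℝ))) * 1 :=
        mul_le_mul_of_nonneg_left (BoxMerging_tv_le_one δ₀ hδ₀ j u u' hu') h2
    _ = (2 : ℝ) ^ (-(σ * (j : ℝ))) := mul_one _

/-! ### Exactness of OR-fusion -/

/-- On consecutive levels the dyadic parent is `t' ↦ ⌊t'/2⌋` (the children filter of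
`CardyGluingRDEBoxMergingRefinement.lean`). [folklore] -/
theorem BoxMerging_dyadicParent_succ_eq_iff (j : ℕ) (s : Fin (2 ^ (j + 1))) (t : Fin (2 ^ j)) :
    dyadicParent (j + 1) j s = t ↔ (s : ℕ) / 2 = (t : ℕ) := by
  rw [Fin.ext_iff, dyadicParent_val_of_le (Nat.le_add_right j 1), Nat.add_sub_cancel_left, pow_one]

/-- **One step of OR-fusion is exact.**  If every coarse event `E a b` (level `j`) is the union of
the fine events `E' a' b'` (level `j+1`) over the children `a'` of `a` and `b'` of `b`, then the
OR-fusion `SegMatrix.coarsen (j+1) j` of the fine matrix read from `ω` is the coarse matrix read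
from `ω`. [folklore] -/
theorem BoxMerging_coarsen_succ_of_biUnion {Ω : Type*} (j : ℕ)
    (E : (Fin 4 × Fin (2 ^ j)) → (Fin 4 × Fin (2 ^ j)) → Set Ω)
    (E' : (Fin 4 × Fin (2 ^ (j + 1))) → (Fin 4 × Fin (2 ^ (j + 1))) → Set Ω)
    (hE : ∀ a b, E a b =
      ⋃ a' ∈ (Finset.univ.filter fun a' : Fin 4 × Fin (2 ^ (j + 1)) =>
          a'.1 = a.1 ∧ (a'.2 : ℕ) / 2 = (a.2 : ℕ)),
        ⋃ b' ∈ (Finset.univ.filter fun b' : Fin 4 × Fin (2 ^ (j + 1)) =>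
            b'.1 = b.1 ∧ (b'.2 : ℕ) / 2 = (b.2 : ℕ)), E' a' b')
    (ω : Ω) (r : SegMatrix (2 ^ j)) (r' : SegMatrix (2 ^ (j + 1)))
    (hr : ∀ a b, r a b = true ↔ ω ∈ E a b) (hr' : ∀ a b, r' a b = true ↔ ω ∈ E' a b) :
    SegMatrix.coarsen (j + 1) j r' = r := by
  funext a b
  refine Bool.eq_iff_iff.2 ?_
  rw [SegMatrix.coarsen_apply_eq_true_iff, hr, hE]
  simp only [mem_iUnion, Finset.mem_filter, Finset.mem_univ, true_and, exists_prop,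
    BoxMerging_dyadicParent_succ_eq_iff, hr']
  constructor
  · rintro ⟨s, t, hs, ht, h⟩
    exact ⟨(a.1, s), ⟨rfl, hs⟩, (b.1, t), ⟨rfl, ht⟩, h⟩
  · rintro ⟨⟨a₁, s⟩, ⟨ha, hs⟩, ⟨b₁, t⟩, ⟨hb, ht⟩, h⟩
    dsimp only at ha hb hs ht
    subst ha hb
    exact ⟨s, t, hs, ht, h⟩

/-- **Exactness of OR-fusion along the dyadic tower.**  For a tower of event families `E j a b`
(`j : ℕ`, indices `Fin 4 × Fin (2^j)`) in which every level-`j` event is the union of the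
level-`(j+1)` events between children, and matrices `r j` read from a configuration `ω`
(`r j a b ↔ ω ∈ E j a b`): `SegMatrix.coarsen K j (r K) = r j` for all `j ≤ K`
(`SegMatrix.coarsen_coarsen` + the one-step exactness). [folklore] -/
theorem BoxMerging_coarsen_read {Ω : Type*}
    (E : (j : ℕ) → (Fin 4 × Fin (2 ^ j)) → (Fin 4 × Fin (2 ^ j)) → Set Ω)
    (hE : ∀ j a b, E j a b =
      ⋃ a' ∈ (Finset.univ.filter fun a' : Fin 4 × Fin (2 ^ (j + 1)) =>
          a'.1 = a.1 ∧ (a'.2 : ℕ) / 2 = (a.2 : ℕ)),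
        ⋃ b' ∈ (Finset.univ.filter fun b' : Fin 4 × Fin (2 ^ (j + 1)) =>
            b'.1 = b.1 ∧ (b'.2 : ℕ) / 2 = (b.2 : ℕ)), E (j + 1) a' b')
    (ω : Ω) (r : (j : ℕ) → SegMatrix (2 ^ j)) (hr : ∀ j a b, r j a b = true ↔ ω ∈ E j a b)
    {j K : ℕ} (hjK : j ≤ K) : SegMatrix.coarsen K j (r K) = r j := by
  obtain ⟨n, rfl⟩ := Nat.exists_eq_add_of_le hjK
  clear hjK
  induction n with
  | zero => exact SegMatrix.coarsen_self j _
  | succ n ih =>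
    show SegMatrix.coarsen (j + n + 1) j (r (j + n + 1)) = r j
    rw [← SegMatrix.coarsen_coarsen (Nat.le_add_right j n) (Nat.le_succ (j + n)),
      BoxMerging_coarsen_succ_of_biUnion (j + n) (E (j + n)) (E (j + n + 1)) (hE (j + n)) ω
        (r (j + n)) (r (j + n + 1)) (hr (j + n)) (hr (j + n + 1)), ih]

/-- **Coarse cells are unions of fine cells over the fibres of OR-fusion** (`j ≤ K`): for a tower
`E` as in `BoxMerging_coarsen_read`, the level-`j` cell of `M'` is the union of the level-`K`
cells of the matrices `M` with `SegMatrix.coarsen K j M = M'`. [folklore] -/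
theorem BoxMerging_stateEvent_eq_biUnion_fiber {Ω : Type*}
    (E : (j : ℕ) → (Fin 4 × Fin (2 ^ j)) → (Fin 4 × Fin (2 ^ j)) → Set Ω)
    (hE : ∀ j a b, E j a b =
      ⋃ a' ∈ (Finset.univ.filter fun a' : Fin 4 × Fin (2 ^ (j + 1)) =>
          a'.1 = a.1 ∧ (a'.2 : ℕ) / 2 = (a.2 : ℕ)),
        ⋃ b' ∈ (Finset.univ.filter fun b' : Fin 4 × Fin (2 ^ (j + 1)) =>
            b'.1 = b.1 ∧ (b'.2 : ℕ) / 2 = (b.2 : ℕ)), E (j + 1) a' b')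
    {j K : ℕ} (hjK : j ≤ K) (M' : SegMatrix (2 ^ j)) :
    {ω | ∀ a b, ω ∈ E j a b ↔ M' a b = true} =
      ⋃ M ∈ (Finset.univ.filter fun M : SegMatrix (2 ^ K) => M' = SegMatrix.coarsen K j M),
        {ω | ∀ a b, ω ∈ E K a b ↔ M a b = true} := by
  classical
  ext ω
  have hex := BoxMerging_coarsen_read E hE ω (fun j a b => decide (ω ∈ E j a b))
    (fun j a b => decide_eq_true_iff) hjK
  rw [BoxMerging_mem_stateEvent_iff]
  simp only [mem_iUnion, Finset.mem_filter, Finset.mem_univ, true_and, exists_prop]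
  constructor
  · intro h
    exact ⟨fun a b => decide (ω ∈ E K a b), by rw [hex, h],
      (BoxMerging_mem_stateEvent_iff _ _ _).2 rfl⟩
  · rintro ⟨M, hM, hω⟩
    rw [(BoxMerging_mem_stateEvent_iff _ _ _).1 hω] at hex
    rw [← hex, hM]

/-- **The reading law and its push-forwards.**  For a probability measure `μ₀`, a tower `E` of
measurable event families as in `BoxMerging_coarsen_read` and a top level `K`, the level-`K` cell
masses form a `PMF (SegMatrix (2^K))` whose push-forward under `SegMatrix.coarsen K j` has the
level-`j` cell masses as coordinates, for every `j ≤ K` (the hypothesis shape of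
`route_Dw_eq_segMultiResTV`). [folklore] -/
theorem BoxMerging_exists_pmf_reading {Ω : Type*} [MeasurableSpace Ω] (μ₀ : Measure Ω)
    [IsProbabilityMeasure μ₀]
    (E : (j : ℕ) → (Fin 4 × Fin (2 ^ j)) → (Fin 4 × Fin (2 ^ j)) → Set Ω)
    (hE : ∀ j a b, E j a b =
      ⋃ a' ∈ (Finset.univ.filter fun a' : Fin 4 × Fin (2 ^ (j + 1)) =>
          a'.1 = a.1 ∧ (a'.2 : ℕ) / 2 = (a.2 : ℕ)),
        ⋃ b' ∈ (Finset.univ.filter fun b' : Fin 4 × Fin (2 ^ (j + 1)) =>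
            b'.1 = b.1 ∧ (b'.2 : ℕ) / 2 = (b.2 : ℕ)), E (j + 1) a' b')
    (hEm : ∀ j a b, MeasurableSet (E j a b)) (K : ℕ) :
    ∃ p : PMF (SegMatrix (2 ^ K)), (∀ M, p M = μ₀ {ω | ∀ a b, ω ∈ E K a b ↔ M a b = true}) ∧
      ∀ j ≤ K, ∀ M', (p.map (SegMatrix.coarsen K j) M').toReal =
        μ₀.real {ω | ∀ a b, ω ∈ E j a b ↔ M' a b = true} := by
  classical
  refine ⟨PMF.ofFintype (fun M => μ₀ {ω | ∀ a b, ω ∈ E K a b ↔ M a b = true})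
    (BoxMerging_sum_measure_stateEvent μ₀ (E K) (hEm K)), fun M => PMF.ofFintype_apply _ M,
    fun j hj M' => ?_⟩
  rw [PMF.map_apply, tsum_fintype, measureReal_def,
    BoxMerging_stateEvent_eq_biUnion_fiber E hE hj M',
    measure_biUnion_finset ((BoxMerging_pairwise_disjoint_stateEvent (E K)).set_pairwise _)
      (fun M _ => BoxMerging_measurableSet_stateEvent (E K) (hEm K) M),
    Finset.sum_filter]
  congr 1
  refine Finset.sum_congr rfl fun M _ => ?_
  rw [PMF.ofFintype_apply]
  split_ifs <;> rfl

/-! ### The route's `Dw` is `segMultiResTV` on the reading laws -/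

/-- **`Dw σ δ₀ K u u' = segMultiResTV σ K μ ν` for the reading laws.**  For every `σ`, `δ₀ > 0`,
`K`, every `ℤ²`-mesh `u` and every `𝕋`-mesh `u' > 0` there are laws
`μ, ν : PMF (SegMatrix (2^K))` — the laws of the level-`K` segment-connectivity matrix of the
square under bond-`ℤ²` percolation at mesh `u` and site-`𝕋` percolation at mesh `u'` — whose
OR-coarsenings to every level `j ≤ K` have the route's reading vectors as coordinates (exactness
of OR-fusion on both lattices), so that the inlined `Dw` of `GluingContraction` IS the Literature
pseudometric `segMultiResTV σ K μ ν` (`route_Dw_eq_segMultiResTV`) and each inlined `TV δ₀ j u u'`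
is the total-variation distance of the level-`j` push-forwards.  Notation of `GluingContraction`,
verbatim. [folklore] -/
theorem BoxMerging_dw_eq_segMultiResTV :
    let PZ := Literature.Probability.Percolation.bondPercolation
      (Literature.Probability.LatticeModels.zdGraph 2) Literature.Probability.Percolation.half
    let PT := Literature.Probability.LatticeModels.triSitePercolation
      Literature.Probability.Percolation.half
    let Sq : ℝ → Set ℂ := fun δ₀ => {z : ℂ | 0 < z.re ∧ z.re < δ₀ ∧ 0 < z.im ∧ z.im < δ₀}
    let seg : (δ₀ : ℝ) → (j : ℕ) → Fin 4 × Fin (2 ^ j) → Set ℂ := fun δ₀ j a =>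
      {z : ℂ | (a.1 = 0 ∧ z.im = 0 ∧ δ₀ * ((a.2 : ℕ) : ℝ) / 2 ^ j ≤ z.re ∧
          z.re ≤ δ₀ * (((a.2 : ℕ) : ℝ) + 1) / 2 ^ j) ∨
        (a.1 = 1 ∧ z.re = δ₀ ∧ δ₀ * ((a.2 : ℕ) : ℝ) / 2 ^ j ≤ z.im ∧
          z.im ≤ δ₀ * (((a.2 : ℕ) : ℝ) + 1) / 2 ^ j) ∨
        (a.1 = 2 ∧ z.im = δ₀ ∧ δ₀ * ((a.2 : ℕ) : ℝ) / 2 ^ j ≤ z.re ∧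
          z.re ≤ δ₀ * (((a.2 : ℕ) : ℝ) + 1) / 2 ^ j) ∨
        (a.1 = 3 ∧ z.re = 0 ∧ δ₀ * ((a.2 : ℕ) : ℝ) / 2 ^ j ≤ z.im ∧
          z.im ≤ δ₀ * (((a.2 : ℕ) : ℝ) + 1) / 2 ^ j)}
    let EZ : (δ₀ : ℝ) → (j : ℕ) → ℝ → ((Fin 4 × Fin (2 ^ j)) → (Fin 4 × Fin (2 ^ j)) → Bool) →
        Set (Literature.Probability.Percolation.BondConfig
          (Literature.Probability.LatticeModels.Site 2)) := fun δ₀ j u M =>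
      {ω | ∀ a b, ω ∈ Literature.Probability.Percolation.discreteCrossing (Sq δ₀) u (seg δ₀ j a)
        (seg δ₀ j b) ↔ M a b = true}
    let ET : (δ₀ : ℝ) → (j : ℕ) → ℝ → ((Fin 4 × Fin (2 ^ j)) → (Fin 4 × Fin (2 ^ j)) → Bool) →
        Set (Literature.Probability.Percolation.SiteConfig
          (Literature.Probability.LatticeModels.Site 2)) := fun δ₀ j u M =>
      {ω | ∀ a b, ω ∈ Literature.Probability.LatticeModels.triCrossing (Sq δ₀) u (seg δ₀ j a)
        (seg δ₀ j b) ↔ M a b = true}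
    let TV : ℝ → ℕ → ℝ → ℝ → ℝ := fun δ₀ j u u' => (1 / 2 : ℝ) *
      ∑ M : (Fin 4 × Fin (2 ^ j)) → (Fin 4 × Fin (2 ^ j)) → Bool,
        |PZ.real (EZ δ₀ j u M) - PT.real (ET δ₀ j u' M)|
    let Dw : ℝ → ℝ → ℕ → ℝ → ℝ → ℝ := fun σ δ₀ K u u' =>
      ∑ j ∈ Finset.range (K + 1), (2 : ℝ) ^ (-(σ * (j : ℝ))) * TV δ₀ j u u'
    ∀ (σ δ₀ : ℝ), 0 < δ₀ → ∀ (K : ℕ) (u u' : ℝ), 0 < u' →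
      ∃ μ ν : PMF (SegMatrix (2 ^ K)),
        (∀ j ≤ K, ∀ M, (μ.map (SegMatrix.coarsen K j) M).toReal = PZ.real (EZ δ₀ j u M)) ∧
        (∀ j ≤ K, ∀ M, (ν.map (SegMatrix.coarsen K j) M).toReal = PT.real (ET δ₀ j u' M)) ∧
        Dw σ δ₀ K u u' = segMultiResTV σ K μ ν ∧
        ∀ j ≤ K, TV δ₀ j u u' =
          (μ.map (SegMatrix.coarsen K j)).tvDist (ν.map (SegMatrix.coarsen K j)) := by
  intro PZ PT Sq seg EZ ET TV Dw σ δ₀ hδ₀ K u u' hu'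
  have hSqR : Sq δ₀ = (rectQuad 0 δ₀ 0 δ₀ hδ₀ hδ₀).carrier := BoxMerging_sq_eq_rectQuad_carrier hδ₀
  have hbdd : Bornology.IsBounded (Sq δ₀) := by
    rw [hSqR]; exact (rectQuad 0 δ₀ 0 δ₀ hδ₀ hδ₀).isBounded
  -- the two towers of crossing events and their refinement identities
  have hZ : ∀ (j : ℕ) (a b : Fin 4 × Fin (2 ^ j)),
      discreteCrossing (Sq δ₀) u (seg δ₀ j a) (seg δ₀ j b) =
        ⋃ a' ∈ (Finset.univ.filter fun a' : Fin 4 × Fin (2 ^ (j + 1)) =>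
            a'.1 = a.1 ∧ (a'.2 : ℕ) / 2 = (a.2 : ℕ)),
          ⋃ b' ∈ (Finset.univ.filter fun b' : Fin 4 × Fin (2 ^ (j + 1)) =>
              b'.1 = b.1 ∧ (b'.2 : ℕ) / 2 = (b.2 : ℕ)),
            discreteCrossing (Sq δ₀) u (seg δ₀ (j + 1) a') (seg δ₀ (j + 1) b') :=
    fun j a b => BoxMerging_discreteCrossing_succ hδ₀ j u a b
  have hT : ∀ (j : ℕ) (a b : Fin 4 × Fin (2 ^ j)),
      triCrossing (Sq δ₀) u' (seg δ₀ j a) (seg δ₀ j b) =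
        ⋃ a' ∈ (Finset.univ.filter fun a' : Fin 4 × Fin (2 ^ (j + 1)) =>
            a'.1 = a.1 ∧ (a'.2 : ℕ) / 2 = (a.2 : ℕ)),
          ⋃ b' ∈ (Finset.univ.filter fun b' : Fin 4 × Fin (2 ^ (j + 1)) =>
              b'.1 = b.1 ∧ (b'.2 : ℕ) / 2 = (b.2 : ℕ)),
            triCrossing (Sq δ₀) u' (seg δ₀ (j + 1) a') (seg δ₀ (j + 1) b') :=
    fun j a b => BoxMerging_triCrossing_succ hδ₀ j u' a b
  obtain ⟨μ, -, hμ⟩ := BoxMerging_exists_pmf_reading PZ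
    (fun j a b => discreteCrossing (Sq δ₀) u (seg δ₀ j a) (seg δ₀ j b)) hZ
    (fun j a b => measurableSet_discreteCrossing (Sq δ₀) u (seg δ₀ j a) (seg δ₀ j b)) K
  obtain ⟨ν, -, hν⟩ := BoxMerging_exists_pmf_reading PT
    (fun j a b => triCrossing (Sq δ₀) u' (seg δ₀ j a) (seg δ₀ j b)) hT
    (fun j a b => BoxMerging_measurableSet_triCrossing hbdd hu' (seg δ₀ j a) (seg δ₀ j b)) K
  refine ⟨μ, ν, hμ, hν, route_Dw_eq_segMultiResTV σ δ₀ K u u' μ ν hμ hν, fun j hj => ?_⟩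
  rw [tvDist_eq_tvFin]
  simp only [hμ j hj, hν j hj]
  rfl

end Summit.CriticalPhenomena.CardyFormulaZ2.Theorems
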